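import Summits.BirchSwinnertonDyer.BirchSwinnertonDyer.Theorems.GenusKolyvaginAtTwoMinimalTwinBSDTwoIdentityDoorChebotarev
import Summits.BirchSwinnertonDyer.BirchSwinnertonDyer.Theorems.GenusKolyvaginAtTwoMinimalTwinBSDTwoDoorOpenPrimes
import Summits.BirchSwinnertonDyer.BirchSwinnertonDyer.Theorems.GenusKolyvaginAtTwoMinimalTwinBSDTwoEggSplit
import Summits.BirchSwinnertonDyer.BirchSwinnertonDyer.Theorems.GenusKolyvaginAtTwoGenusPrimitiveSupplyAtTwoArchimedeanRelaxedSwitchEgg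
import Summits.BirchSwinnertonDyer.BirchSwinnertonDyer.Theorems.GenusKolyvaginAtTwoGenusPrimitiveSupplyAtTwoLocalTwoTorsion
import Summits.BirchSwinnertonDyer.BirchSwinnertonDyer.Theorems.GenusKolyvaginAtTwoGenusPrimitiveSupplyAtTwoConjugationTypeAtTwo
import Summits.BirchSwinnertonDyer.Rank1Residual.GaloisImage.KolyvaginPrimeFlagLevelOne
import Literature.NumberTheory.EllipticCurves.BinaryQuarticStabilizerTorsion
import HarnessLib

/-!
# Route `GenusKolyvaginAtTwo`, crux U₂ `MinimalTwinBSDTwo` (stmt-BirchSwinnertonDyer-22985), LINE 23 «twin_swap»: THE IDENTITY-PRIME DOOR, part 5 —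
# THE IDENTITY-DOOR SUPPLY `IdentityDoorSupplyAtTwo` IS A THEOREM modulo GZK: for every curve of U₂'s `Δ > 0` identity locus with `ρ̄_{W,2}` onto there is a
# prime Heegner field `ℚ(√−ℓ)` with `ℓ` an IDENTITY prime (`#W(ℚ_ℓ)[2] = 4`) at which `Sel₂^{rel ∞}(W)` localises injectively, and a globally minimal twin

Seat `bsd-line-gk2-p2` g26 (PROVER seat 2/3, cell `bsd-f1-sign2`, LINE 23 holder), `--supports stmt-BirchSwinnertonDyer-22985` (helper; closes nothing).
THEOREMS ONLY (no definition, no named fact, no `sorry`); standard axioms.  **BSD is NOT proved by this file; U₂ is NOT proved; nothing is closed.**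
CONDITIONAL only on Gross–Zagier–Kolyvagin (`rank_eq_analyticRank_of_analyticRank_le_one`, the route's print item 19921) to turn `r_an = 1` into rank `1`;
everything else — Čebotarev (`exists_identityPrime_pair_not_mem_strictLocalKer`, part 4b), the prime Heegner field (`GenusKolyTwin.exists_heegnerField_of_prime`),
the ∞-relaxed count `#Sel₂^{rel ∞}(W) = 4` (`GenusKolyArch.natCard_selmerGroupRelaxedAtInfinityAtTwo_eq_four_of_not_meetsEgg`), the reduction count at an
identity prime (Silverman VII.3.1 via `GaloisImage.FrobShape.exists_frobenius_natCard_fixed_eq`, Hensel via `GenusKolyTwin.natCard_twoTorsion_padic_eq`) and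
the global minimal model of the twist — is a tree theorem.

* §1 `natCard_twoTorsion_reductionAt_eq_four_of_frob_fix` — at an odd good prime `ℓ` with an arithmetic Frobenius FIXING `E[2]`: `#Ẽ_v(k_v)[2] = 4`
  (gk2-p5 / GenusKolySign's `…_of_frobEqFrobInfty_of_Δ_pos` with Gross's (3.2) replaced by the Frobenius itself).
* §2 `natCard_twoTorsion_padic_eq_four_of_frob_fix` — hence the `2`-division cubic has three roots mod `ℓ` and **`#W(ℚ_ℓ)[2] = 4`**.
* §3 `eq_zero_of_mem_of_card_eq_four` — the Klein four-group bookkeeping: in an additive subgroup `R` of order `4` in which `x, y, x + y` (`x ≠ 0`, `y ≠ 0`,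
  `x ≠ y`, all in `R`) avoid a subgroup `L`, every element of `R ∩ L` is `0`.
* §4 **`identityDoorSupplyAtTwo_of_GZK`** — the text of LINE 23 v2.0's `IdentityDoorSupplyAtTwo` (skeleton `Cruxes/MinimalTwinBSDTwo/Lines/twin_swap.lean`),
  from GZK alone.

References: [MazurRubin2010] Prop. 3.3, Lemma 3.5; [GrossLMS1991] §1, §9; [Kramer1981] Prop. 3; [SilvermanAEC2009] VII.3.1(b), VIII.8 Cor. 8.3, III.6.4(b).
-/

set_option linter.dupNamespace false -- tree convention: `Summit.BirchSwinnertonDyer.BirchSwinnertonDyer.Theorems` (summit = sub-problem)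
set_option autoImplicit false

noncomputable section

open scoped Classical

namespace Summit.BirchSwinnertonDyer.BirchSwinnertonDyer.Theorems.GenusExact.TwinSwap.IdentityDoor

open Polynomial WeierstrassCurve NumberField IsDedekindDomain Field
open Literature.NumberTheory.GaloisRepresentations Literature.NumberTheory.EllipticCurves
open Literature.NumberTheory.EllipticCurves.Rank1Residual
open Summit.BirchSwinnertonDyer.BirchSwinnertonDyer.Theorems.KolyvaginEigenTwo
open Summit.BirchSwinnertonDyer.BirchSwinnertonDyer.Theorems.GenusKolySign
open Summit.BirchSwinnertonDyer.Rank1Residual.F1Sign2 (MeetsEgg NoRationalTwoTorsion ShaTwoTrivial selmerGroupRelaxedAtInfinityAtTwo)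
open Summit.BirchSwinnertonDyer.BirchSwinnertonDyer.Theorems.GenusKolyTwin (exists_heegnerField_of_prime prime_discr_facts natCard_twoTorsion_padic_eq
  isRoot_twoTorsionPolynomial_map_zmod_iff)
open Summit.BirchSwinnertonDyer.BirchSwinnertonDyer.Theorems.GenusExact.TwinSwap.Egg (shaTwoTrivial_of_natCard_selmerGroup_eq_two)

variable (W : WeierstrassCurve ℚ) [W.IsElliptic]

/-! ## §1 Reduction: an identity Frobenius gives four `k_v`-rational `2`-torsion points -/

/-- **`#Ẽ(𝔽_ℓ)[2] = 4` at an identity prime.**  `W/ℚ` globally minimal, `ℓ` an odd prime of good reduction with an arithmetic Frobenius at some prime above `ℓ`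
acting TRIVIALLY on `E[2]`, `v` the place of `ℚ` at `ℓ`: the reduction `Ẽ_v` has FOUR `k_v`-rational `2`-torsion points.  Reduction identifies `Ẽ_v(k_v)[2]`
with the fixed points on `E[2]` of an arithmetic Frobenius `σ₀` at some `𝔓₀ ∣ v` (Silverman VII.3.1(b)); moving `𝔓₀` to the given prime and comparing the two
Frobenius elements up to inertia (trivial on `E[2]`, VII.4.1(a)) shows `σ₀` fixes `E[2]` pointwise; `#E[2] = 4` (III.6.4(b)).  GenusKolySign's
`natCard_twoTorsion_reductionAt_eq_four_of_frobEqFrobInfty_of_Δ_pos` with the Frobenius displayed instead of Gross's (3.2).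
[cite: SilvermanAEC2009, Prop. VII.3.1(b), Prop. VII.4.1(a), Cor. III.6.4(b)] -/
theorem natCard_twoTorsion_reductionAt_eq_four_of_frob_fix [W.IsGloballyMinimal] {ℓ : ℕ} [Fact ℓ.Prime] (hℓ2 : ℓ ≠ 2)
    (hgoodℓ : W.HasGoodReductionAtPrime ℓ)
    (hfrob : ∃ (v' : HeightOneSpectrum (𝓞 ℚ)) (𝔓 : Ideal (absIntegers (𝓞 ℚ) ℚ)) (h : absoluteGaloisGroup ℚ),
      (ℓ : 𝓞 ℚ) ∈ v'.asIdeal ∧ 𝔓 ∈ v'.primesAbove ∧ IsArithFrobAt (𝓞 ℚ) h 𝔓 ∧ ∀ P : geomTorsion W (2 : ℤ), h • P = P)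
    {v : HeightOneSpectrum (𝓞 ℚ)} (hv : (ℓ : 𝓞 ℚ) ∈ v.asIdeal) :
    Nat.card (AddSubgroup.torsionBy (W.reductionAt v).toAffine.Point ((2 : ℕ) : ℤ)) = 4 := by
  haveI : Fact (Nat.Prime 2) := ⟨Nat.prime_two⟩
  have hℓp : ℓ.Prime := Fact.out
  obtain ⟨v', 𝔓, h, hv', h𝔓, hfr, hfix⟩ := hfrob
  -- the place above `ℓ` is unique
  have hvℓ : (Rat.HeightOneSpectrum.primesEquiv v : ℕ) = ℓ := primesEquiv_eq_of_natCast_mem hℓp hv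
  have hvv : v' = v := by
    have h1 : (Rat.HeightOneSpectrum.primesEquiv v' : ℕ) = ℓ := primesEquiv_eq_of_natCast_mem hℓp hv'
    exact Rat.HeightOneSpectrum.primesEquiv.injective (Subtype.ext (h1.trans hvℓ.symm))
  rw [hvv] at h𝔓
  -- a Frobenius `σ₀` whose fixed points on `E[2]` count `Ẽ_v(k_v)[2]`
  obtain ⟨σ₀, 𝔓₀, h𝔓₀, hσ₀, hcount⟩ :=
    Summit.BirchSwinnertonDyer.Rank1Residual.GaloisImage.FrobShape.exists_frobenius_natCard_fixed_eq
      W 2 ℓ hℓ2 hgoodℓ hv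
  have hc1 := hcount 1
  rw [pow_one] at hc1
  rw [← hc1]
  -- move `σ₀` to `𝔓` and compare with `h` up to inertia
  obtain ⟨g, hg⟩ := IsDedekindDomain.HeightOneSpectrum.exists_smul_eq_of_mem_primesAbove_holds h𝔓₀ h𝔓
  have hσ₁ : IsArithFrobAt (NumberField.RingOfIntegers ℚ) (g * σ₀ * g⁻¹) 𝔓 := hg ▸ hσ₀.conj g
  have hI := hfr.mul_inv_mem_inertia hσ₁
  have hgood : W.HasGoodReductionAt v := (hasGoodReductionAtPrime_primesEquiv_iff_holds W v ℓ hvℓ).mp hgoodℓ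
  have h2v : (2 : NumberField.RingOfIntegers ℚ) ∉ v.asIdeal := fun h2 ↦
    hℓ2 (hvℓ.symm.trans (primesEquiv_eq_of_natCast_mem Nat.prime_two (by exact_mod_cast h2)))
  have h2v' : ((((2 : ℕ) : ℤ)) : NumberField.RingOfIntegers ℚ) ∉ v.asIdeal := by
    rw [Int.cast_natCast]; exact_mod_cast h2v
  have hσσ₁ : ∀ P : geomTorsion W ((2 : ℕ) : ℤ), h • P = (g * σ₀ * g⁻¹) • P := fun P ↦ by
    have h' := W.smul_geomTorsion_eq_of_mem_inertia hgood h2v' h𝔓 hI ((g * σ₀ * g⁻¹) • P)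
    rwa [mul_smul, inv_smul_smul] at h'
  -- so `σ₀` fixes `E[2]` pointwise
  have hall : ∀ P : geomTorsion W ((2 : ℕ) : ℤ), σ₀ • P = P := fun P ↦ by
    have h' : (g * σ₀ * g⁻¹) • (g • P) = g • P := by rw [← hσσ₁]; exact hfix (g • P)
    rw [mul_smul, mul_smul, inv_smul_smul] at h'
    exact smul_left_cancel g h'
  have hfixAll : Nat.card {P : geomTorsion W ((2 : ℕ) : ℤ) // σ₀ • P = P} =
      Nat.card (geomTorsion W ((2 : ℕ) : ℤ)) := Nat.card_congr (Equiv.subtypeUnivEquiv hall)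
  rw [hfixAll]
  have hE : Nat.card (geomTorsion W ((2 : ℕ) : ℤ)) = 2 ^ 2 :=
    card_torsionPoints_eq_sq_holds W (AlgebraicClosure ℚ) (by norm_num)
  rw [hE]; norm_num

/-! ## §2 Hensel: three roots mod `ℓ`, so `#W(ℚ_ℓ)[2] = 4` -/

/-- **`#W(ℚ_ℓ)[2] = 4` at an identity prime** (`W/ℚ` globally minimal, `ℓ` odd, `ℓ ∤ N_W`, an arithmetic Frobenius at `ℓ` fixing `E[2]`): §1 gives four
`2`-torsion points on the reduction, i.e. on the integral model mod `ℓ` (`GaloisImage.KolyvaginPrime.natCard_torsionBy_reductionAt_eq'`), so the `2`-division cubic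
`4x³ + b₂x² + 2b₄x + b₆` has THREE roots mod `ℓ` (`natCard_torsionBy_two_eq` over `ℤ/ℓ`); Hensel (`GenusKolyTwin.natCard_twoTorsion_padic_eq`) lifts them.
[cite: SilvermanAEC2009, VII.3 Prop. 3.1(b), III.1] [cite: MazurRubin2010, Lemma 2.2 (i)] -/
theorem natCard_twoTorsion_padic_eq_four_of_frob_fix [W.IsGloballyMinimal] {ℓ : ℕ} [Fact ℓ.Prime] (hℓ2 : ℓ ≠ 2)
    (hℓN : ¬ ℓ ∣ W.conductorNorm ℤ)
    (hfrob : ∃ (v' : HeightOneSpectrum (𝓞 ℚ)) (𝔓 : Ideal (absIntegers (𝓞 ℚ) ℚ)) (h : absoluteGaloisGroup ℚ),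
      (ℓ : 𝓞 ℚ) ∈ v'.asIdeal ∧ 𝔓 ∈ v'.primesAbove ∧ IsArithFrobAt (𝓞 ℚ) h 𝔓 ∧ ∀ P : geomTorsion W (2 : ℤ), h • P = P) :
    Nat.card {Q : (W.baseChange ℚ_[ℓ]).toAffine.Point // 2 • Q = 0} = 4 := by
  have hℓp : ℓ.Prime := Fact.out
  have hgoodℓ : W.HasGoodReductionAtPrime ℓ := by
    by_contra h
    exact hℓN ((W.dvd_conductorNorm_iff_not_hasGoodReductionAtPrime ℓ).mpr h)
  have hℓΔ : ¬ (ℓ : ℤ) ∣ minimalDiscriminantInt W := fun h ↦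
    hℓN (GenusKolyTwin.dvd_conductorNorm_of_dvd_minimalDiscriminantInt W hℓp h)
  -- the place over `ℓ`
  obtain ⟨v, hv⟩ : ∃ v : HeightOneSpectrum (𝓞 ℚ), ((Rat.HeightOneSpectrum.primesEquiv v : Nat.Primes) : ℕ) = ℓ :=
    ⟨Rat.HeightOneSpectrum.primesEquiv.symm ⟨ℓ, hℓp⟩, by rw [Equiv.apply_symm_apply]⟩
  have hℓv : (ℓ : 𝓞 ℚ) ∈ v.asIdeal := by
    rw [← hv]
    exact Rat.HeightOneSpectrum.natCast_natGenerator_mem v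
  -- four `2`-torsion points on the reduction, i.e. on the integral model mod `ℓ`
  have hred := natCard_twoTorsion_reductionAt_eq_four_of_frob_fix W hℓ2 hgoodℓ hfrob hℓv
  rw [Summit.BirchSwinnertonDyer.Rank1Residual.GaloisImage.KolyvaginPrime.natCard_torsionBy_reductionAt_eq' W hℓv 2] at hred
  -- the integral model mod `ℓ` is elliptic
  set M : WeierstrassCurve (ZMod ℓ) := (integralModelInt W).map (Int.castRingHom (ZMod ℓ)) with hM
  have h2 : (2 : ZMod ℓ) ≠ 0 := by
    have : ((2 : ℕ) : ZMod ℓ) ≠ 0 := by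
      rw [Ne, ZMod.natCast_eq_zero_iff]
      intro h
      exact hℓ2 ((Nat.prime_dvd_prime_iff_eq hℓp Nat.prime_two).mp h)
    exact_mod_cast this
  have hΔ0 : M.Δ ≠ 0 := by
    rw [hM, WeierstrassCurve.map_Δ, Ne, eq_intCast, ZMod.intCast_zmod_eq_zero_iff_dvd]
    exact hℓΔ
  haveI : M.IsElliptic := ⟨hΔ0.isUnit⟩
  -- `#M(𝔽_ℓ)[2] = #roots + 1` (the `DecidableEq (ZMod ℓ)` instances hidden in the point group are reconciled by `convert`)
  have hroots : Nat.card (AddSubgroup.torsionBy M.toAffine.Point (2 : ℤ)) =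
      {x : ZMod ℓ | M.twoTorsionPolynomial.toPoly.IsRoot x}.ncard + 1 := by
    convert WeierstrassCurve.natCard_torsionBy_two_eq M h2
  have hcardM' : Nat.card {P : M.toAffine.Point // 2 • P = 0} = Nat.card (AddSubgroup.torsionBy M.toAffine.Point (2 : ℤ)) := by
    refine Nat.card_congr (Equiv.subtypeEquivRight fun Q => ?_)
    rw [Submodule.mem_toAddSubgroup, Submodule.mem_torsionBy_iff, two_zsmul, two_nsmul]
  have hred' : Nat.card {P : M.toAffine.Point // 2 • P = 0} = 4 := by convert hred
  have hcardM : Nat.card {P : M.toAffine.Point // 2 • P = 0} = {x : ZMod ℓ | M.twoTorsionPolynomial.toPoly.IsRoot x}.ncard + 1 := by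
    rw [hcardM', hroots]
  have hset : {x : ZMod ℓ | M.twoTorsionPolynomial.toPoly.IsRoot x} =
      {x : ZMod ℓ | 4 * x ^ 3 + ((integralModelInt W).b₂ : ZMod ℓ) * x ^ 2 +
        2 * ((integralModelInt W).b₄ : ZMod ℓ) * x + ((integralModelInt W).b₆ : ZMod ℓ) = 0} := by
    ext x
    rw [Set.mem_setOf_eq, Set.mem_setOf_eq, ← isRoot_twoTorsionPolynomial_map_zmod_iff W x, hM,
      WeierstrassCurve.map_twoTorsionPolynomial, Cubic.map_toPoly]
  have hncard : {x : ZMod ℓ | 4 * x ^ 3 + ((integralModelInt W).b₂ : ZMod ℓ) * x ^ 2 +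
      2 * ((integralModelInt W).b₄ : ZMod ℓ) * x + ((integralModelInt W).b₆ : ZMod ℓ) = 0}.ncard = 3 := by
    rw [← hset]
    have h := hred'
    rw [hcardM] at h
    omega
  rw [natCard_twoTorsion_padic_eq W hℓ2 hℓΔ, hncard]

/-! ## §3 Klein-four bookkeeping -/

/-- In an additive subgroup `R` with `Nat.card R = 4` containing `x ≠ 0`, `y ≠ 0` with `x ≠ y` (so `R = {0, x, y, x + y}`, every element being `2`-torsion),
if `x`, `y`, `x + y` lie outside a subgroup `L`, then `R ⊓ L = 0`. [folklore] -/
theorem eq_zero_of_mem_of_card_eq_four {G : Type*} [AddCommGroup G] (R L : AddSubgroup G) (hR : Nat.card R = 4)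
    (h2 : ∀ g : G, g + g = 0) {x y : G} (hxR : x ∈ R) (hyR : y ∈ R) (hx : x ≠ 0) (hy : y ≠ 0) (hxy : x ≠ y)
    (hxL : x ∉ L) (hyL : y ∉ L) (hxyL : x + y ∉ L) : ∀ c ∈ R, c ∈ L → c = 0 := by
  intro c hcR hcL
  by_contra hc0
  have hcx : c ≠ x := fun h ↦ hxL (h ▸ hcL)
  have hcy : c ≠ y := fun h ↦ hyL (h ▸ hcL)
  have hcxy : c ≠ x + y := fun h ↦ hxyL (h ▸ hcL)
  have hxy0 : x + y ≠ 0 := fun h ↦ hxy (by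
    have := eq_neg_of_add_eq_zero_left h
    rw [this, neg_eq_iff_add_eq_zero, h2])
  have hxyx : x + y ≠ x := fun h ↦ hy (by simpa using h)
  have hxyy : x + y ≠ y := fun h ↦ hx (by simpa using h)
  -- five distinct elements in a group of order four
  haveI : Finite R := Nat.finite_of_card_ne_zero (by rw [hR]; norm_num)
  haveI : Fintype R := Fintype.ofFinite R
  let S : Finset R := {⟨0, R.zero_mem⟩, ⟨x, hxR⟩, ⟨y, hyR⟩, ⟨x + y, R.add_mem hxR hyR⟩, ⟨c, hcR⟩}
  have hS : S.card = 5 := by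
    simp only [S]
    rw [Finset.card_insert_of_notMem, Finset.card_insert_of_notMem, Finset.card_insert_of_notMem, Finset.card_insert_of_notMem,
      Finset.card_singleton]
    · simp only [Finset.mem_singleton, Subtype.mk.injEq]; exact fun h ↦ hcxy h.symm
    · simp only [Finset.mem_insert, Finset.mem_singleton, Subtype.mk.injEq, not_or]; exact ⟨hxyy.symm ∘ Eq.symm ∘ Eq.symm, fun h ↦ hcy h.symm⟩
    · simp only [Finset.mem_insert, Finset.mem_singleton, Subtype.mk.injEq, not_or]
      exact ⟨hxy, hxyx.symm ∘ Eq.symm ∘ Eq.symm, fun h ↦ hcx h.symm⟩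
    · simp only [Finset.mem_insert, Finset.mem_singleton, Subtype.mk.injEq, not_or]
      exact ⟨hx.symm, hy.symm, hxy0.symm, fun h ↦ hc0 h.symm⟩
  have hle : S.card ≤ Fintype.card R := Finset.card_le_univ S
  rw [hS, Fintype.card_eq_nat_card, hR] at hle
  omega

/-! ## §4 The identity-door supply of LINE 23 v2.0, from GZK -/

/-- **THE IDENTITY-DOOR SUPPLY IS A THEOREM modulo GZK.**  For `W/ℚ` globally minimal, non-CM, `r_an(W) = 1`, `#Sel₂(W) = 2`, `ρ̄_{W,2}` onto, `Δ_W > 0`,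
`W(ℚ) ⊂ W⁰(ℝ)` (`¬ MeetsEgg`): there are an imaginary quadratic `K = ℚ(√−ℓ)` (`ℓ` prime, `d_K = −ℓ` odd `≠ −3`, Heegner for `N_W`, `2` split) such that
**`ℓ` is an IDENTITY prime (`#W(ℚ_ℓ)[2] = 4`) and no non-zero class of `Sel₂^{rel ∞}(W)` lies in `strictLocalKer_ℓ`**, and a globally minimal model of
`W^{(d_K)}`.  Proof: GZK gives rank `1`, so `Sel₂^{rel ∞}(W)` has order `4` (gk2-p5) and is `{0, x, y, x + y}`; Čebotarev for the pair (part 4b) gives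
`ℓ ≡ 7 (8)`, `ℓ ≡ −1 (mod p ∣ N_W)` with a Frobenius fixing `E[2]` and `x, y, x + y ∉ strictLocalKer_ℓ`; the prime Heegner field (gk2-p5) and a global
minimal model of the twist (Silverman VIII.8).  The text proved is LINE 23 v2.0's `IdentityDoorSupplyAtTwo` VERBATIM.  CONDITIONAL on `hGZK` only; proves
nothing about BSD; closes nothing.  [cite: MazurRubin2010, Prop. 3.3, Lemma 3.5] [cite: GrossLMS1991, §1 (p. 235)] [cite: SilvermanAEC2009, VIII.8 Cor. 8.3] -/
theorem identityDoorSupplyAtTwo_of_GZK (hGZK : rank_eq_analyticRank_of_analyticRank_le_one) :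
    ∀ (W : WeierstrassCurve ℚ) [W.IsElliptic] [W.IsGloballyMinimal] [NeZero (W.conductorNorm ℤ)],
      ¬ W.HasCM → W.analyticRank = 1 → Nat.card (W.selmerGroup 2) = 2 → W.HasSurjectiveModNGaloisRep 2 → 0 < W.Δ → ¬ MeetsEgg W →
      ∃ (K : Type) (_ : Field K) (_ : NumberField K) (ℓ : ℕ) (_ : Fact ℓ.Prime),
        IsImaginaryQuadratic K ∧ NumberField.discr K = -(ℓ : ℤ) ∧
        Nat.card {Q : (W.baseChange ℚ_[ℓ]).toAffine.Point // 2 • Q = 0} = 4 ∧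
        (∀ c ∈ selmerGroupRelaxedAtInfinityAtTwo W, c ∈ MazurRubin2010.strictLocalKer W ℚ_[ℓ] 2 → c = 0) ∧
        Odd (NumberField.discr K) ∧ NumberField.discr K ≠ -3 ∧ SatisfiesHeegnerHypothesis (W.conductorNorm ℤ) K ∧
        ((Ideal.span {(2 : ℤ)}).primesOver (𝓞 K)).ncard = 2 ∧
        ∃ (Wd : WeierstrassCurve ℚ) (_ : Wd.IsElliptic) (_ : Wd.IsGloballyMinimal),
          ∃ C : VariableChange ℚ, C • W.quadraticTwist (NumberField.discr K : ℚ) = Wd := by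
  intro W _ _ _ _hcm hr hSel hsurj hΔ hegg
  haveI : Fact (Nat.Prime 2) := ⟨Nat.prime_two⟩
  -- rank one (GZK), the ∞-relaxed Selmer group has order four
  have hrk : W.mordellWeilRank = 1 := by rw [(hGZK W (le_of_eq hr)).1, hr]
  have hT : NoRationalTwoTorsion W := GenusKolyTwin.noRationalTwoTorsion_of_hasSurjectiveModNGaloisRep W (by simpa using hsurj)
  have hSha : ShaTwoTrivial W := shaTwoTrivial_of_natCard_selmerGroup_eq_two W hSel (le_of_eq hrk.symm)
  have hR4 : Nat.card (selmerGroupRelaxedAtInfinityAtTwo W) = 4 :=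
    GenusKolyArch.natCard_selmerGroupRelaxedAtInfinityAtTwo_eq_four_of_not_meetsEgg W hΔ hT hrk hSha hegg
  set R := selmerGroupRelaxedAtInfinityAtTwo W with hRdef
  haveI : Finite R := Nat.finite_of_card_ne_zero (by rw [hR4]; norm_num)
  -- two independent classes `x, y ∈ R`
  obtain ⟨x, hxR, hx0⟩ : ∃ x ∈ R, x ≠ 0 := by
    by_contra h
    push Not at h
    have : Nat.card R = 1 := by
      rw [Nat.card_eq_one_iff_exists]
      refine ⟨⟨0, R.zero_mem⟩, fun z ↦ Subtype.ext (h z.1 z.2)⟩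
    rw [hR4] at this; omega
  obtain ⟨y, hyR, hy0, hyx⟩ : ∃ y ∈ R, y ≠ 0 ∧ y ≠ x := by
    by_contra h
    push Not at h
    haveI : Fintype R := Fintype.ofFinite R
    have hsub : (Finset.univ : Finset R) ⊆ {⟨0, R.zero_mem⟩, ⟨x, hxR⟩} := by
      intro z _
      simp only [Finset.mem_insert, Finset.mem_singleton]
      by_cases hz : z.1 = 0
      · exact Or.inl (Subtype.ext hz)
      · exact Or.inr (Subtype.ext (h z.1 z.2 hz))
    have hle := Finset.card_le_card hsub
    rw [Finset.card_univ, Fintype.card_eq_nat_card, hR4] at hle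
    have : ({⟨0, R.zero_mem⟩, ⟨x, hxR⟩} : Finset R).card ≤ 2 := Finset.card_le_two
    omega
  -- `2`-torsion in `H¹(ℚ, E[2])`
  have hE2 : ∀ P : geomTorsion W ((2 : ℕ) : ℤ), 2 • P = 0 := fun P ↦ AddSubgroup.torsionBy.nsmul P
  have h2H : ∀ g : W.galH1Torsion ((2 : ℕ) : ℤ), g + g = 0 := fun g ↦ by
    rw [← two_nsmul]
    exact galoisCohomology.nsmul_eq_zero_of_forall (W.torsionGaloisModule ((2 : ℕ) : ℤ)) hE2 g
  -- Čebotarev: an identity twisting prime for the pair `(x, y)`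
  have hN : W.conductorNorm ℤ ≠ 0 := (W.conductorNorm_pos_holds).ne'
  obtain ⟨ℓ, hℓF, -, hℓ2N, hℓ8, hℓp, hfrob, hxL, hyL, hxyL⟩ :=
    exists_identityPrime_pair_not_mem_strictLocalKer W hsurj hΔ (x := x) (y := y) hx0 hy0 (Ne.symm hyx) hN 0
  have hℓ : ℓ.Prime := hℓF.out
  have hℓ2 : ℓ ≠ 2 := fun h ↦ hℓ2N (by rw [h]; exact dvd_mul_right 2 _)
  have hℓN : ¬ ℓ ∣ W.conductorNorm ℤ := fun h ↦ hℓ2N (h.mul_left 2)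
  have hℓp' : ∀ p : ℕ, p.Prime → p ∣ W.conductorNorm ℤ → p ≠ 2 → (ℓ : ZMod p) = -1 := by
    intro p _ hp _
    have h : ((ℓ + 1 : ℕ) : ZMod p) = 0 := (ZMod.natCast_eq_zero_iff _ _).mpr (hℓp p hp)
    rw [Nat.cast_add, Nat.cast_one] at h
    exact eq_neg_of_add_eq_zero_left h
  -- the prime Heegner field and a globally minimal model of the twist
  obtain ⟨-, -, K, _, _, hK, hd, hodd, hd3, hH, h2K, -, -⟩ := exists_heegnerField_of_prime W hℓ hℓ8 hℓp'
  have hd0 : ((NumberField.discr K : ℤ) : ℚ) ≠ 0 := by exact_mod_cast NumberField.discr_ne_zero K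
  haveI := W.isElliptic_quadraticTwist hd0
  obtain ⟨C, hC⟩ := hasGlobalMinimalModel_rat_holds (W.quadraticTwist ((NumberField.discr K : ℤ) : ℚ))
  haveI := hC
  -- the identity count and the injectivity on `R`
  have hid : Nat.card {Q : (W.baseChange ℚ_[ℓ]).toAffine.Point // 2 • Q = 0} = 4 :=
    natCard_twoTorsion_padic_eq_four_of_frob_fix W hℓ2 hℓN
      (by obtain ⟨v, 𝔓, F, hv, h𝔓, hF, hfix⟩ := hfrob; exact ⟨v, 𝔓, F, hv, h𝔓, hF, hfix⟩)
  have hinj : ∀ c ∈ R, c ∈ MazurRubin2010.strictLocalKer W ℚ_[ℓ] 2 → c = 0 :=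
    eq_zero_of_mem_of_card_eq_four R (MazurRubin2010.strictLocalKer W ℚ_[ℓ] 2) hR4 h2H hxR hyR hx0 hy0 (Ne.symm hyx) hxL hyL hxyL
  exact ⟨K, inferInstance, inferInstance, ℓ, hℓF, hK, hd, hid, hinj, hodd, hd3, hH, h2K,
    C • W.quadraticTwist ((NumberField.discr K : ℤ) : ℚ), inferInstance, hC, C, rfl⟩

end Summit.BirchSwinnertonDyer.BirchSwinnertonDyer.Theorems.GenusExact.TwinSwap.IdentityDoor

end
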